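import Summits.HodgeConjecture.HodgeCM.Model.Binders.ArchKTypeAt_1

/-! PORT of `HodgeCM/Model/Binders/ArchKTypeAt.lean` (HodgeCMPerL run 82) — part 2: continuation of `Summits.HodgeConjecture.HodgeCM.Model.Binders.ArchKTypeAt_1` (split at a top-level declaration boundary by port_pkg.py; scope re-opened below; declarations unchanged). -/

-- port_pkg: scope re-opened for this part (file-level context, then the namespace/section stack open at the cut)
set_option autoImplicit false
noncomputable section
open Filter Topology
open scoped Classical SchwartzMap NumberField
open MulAction NumberField.mixedEmbedding IsDedekindDomain
open Literature.NumberTheory.Automorphic Literature.NumberTheory.Weil1964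
open Literature.NumberTheory.Automorphic.WeightForms (restrictHom IsLevelCorrected IsWeightMatched)
open Literature.AlgebraicGeometry.HodgeTheory
open Literature.AlgebraicGeometry.ShimuraVarieties
open Literature.NumberTheory.Automorphic.PicardCM
open HodgeCM.PerL34.Seesaw HodgeCM.PerL34.RationalCoset HodgeCM.PerL34.SupplyAdelic
open HodgeCM.Model.SupplyInstance HodgeCM.Model.SupplyResidual
open HodgeCM.Model.ThetaSpace HodgeCM.Model.ArchSideTerm
namespace HodgeCM
namespace Model
section Generic
variable {U : Universe} {Lc : CMField} {ι₁ : Lc →+* ℂ} {V : HermSpace3 Lc ι₁} {c : SeesawCtx Lc}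
namespace ArchKTypeDataAt
variable {X : ThetaSpaceInput U V c} {k : Fin 4} {xc : X.J → FiniteAdeleRing (𝓞 X.K) X.K} {𝔫 : Ideal (𝓞 X.K)}
  (B : ArchKTypeDataAt X k xc 𝔫)
variable [IsTopologicalGroup X.GU] [LocallyCompactSpace X.GU] [CompactSpace (X.GU ⧸ (X.P k).ΓU)] in
/-- **(H1) + (AN) + (REP′) ⇒ per covector**: the `ℓ`-component of `b ↦ Θ_f(y · ι_∞(e b))` is real-differentiable at `0`
with complex-linear differential. -/
theorem differentiableAt_apply_thetaFormOf {P' : Type*} [NormedAddCommGroup P'] [NormedSpace ℝ P']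
    [Module ℂ P'] (e : P' → X.G₁) (hT : (X.P k).IsThetaArchContinuousAt xc 𝔫) (hd : B.IsWeaklyPDiff e)
    (hCR : B.IsWeaklyCR e) (f : C(relNormOneIdeles X.K X.L ⧸ relNormOneRat X.K X.L, ℂ)) (y : X.GU)
    (ℓ : Module.Dual ℂ X.W) :
    DifferentiableAt ℝ (fun b => ℓ ((B.thetaFormOf f).1 (y * X.ιinf B.Γ₀ (e b)))) 0 ∧
      ∀ v : P',
        fderiv ℝ (fun b => ℓ ((B.thetaFormOf f).1 (y * X.ιinf B.Γ₀ (e b)))) 0 (Complex.I • v) =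
          Complex.I • fderiv ℝ (fun b => ℓ ((B.thetaFormOf f).1 (y * X.ιinf B.Γ₀ (e b)))) 0 v := by
  have hfun : (fun b => ℓ ((B.thetaFormOf f).1 (y * X.ιinf B.Γ₀ (e b)))) =
      fun b => (X.P k).thetaArchCLMAt hT f y (B.ωinf (e b) (B.Φarch ℓ)) :=
    funext fun b => B.apply_thetaFormOf_mul_ιinf f y (e b) ℓ
  rw [hfun]
  exact ⟨hd _ ℓ, hCR _ ℓ⟩

end ArchKTypeDataAt

end Generic

/-! ## 3. At the pin: holomorphic type, admissibility, the frame, and the admissible wedge of a pair -/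

section Pin

variable (hHD : exists_isReal_hodgeModel) (hI : hodgePQ_independent_of_hodgeModel)
  (h₁ : BallQuotientUniformised)  (h₃ : CMAbelianVarietyRealised)

variable {L : CMField} {ι₁ : L →+* ℂ} {V : HermSpace3 L ι₁} {c : SeesawCtx L}

variable {hHD hI h₁ h₃} in
/-- At the pin (`W = ℂ²`), the theta form of the family read as a `ℂ²`-valued function on `G_U(𝔸)`. -/
def ArchKTypeDataAt.thetaFunIn {S : ThetaAdelicSide V c} {h : IsAnisotropic L V.Hm} {k : Fin 4}
    {xc : Fin 3 → FiniteAdeleRing (𝓞 ↥(NumberField.maximalRealSubfield L)) ↥(NumberField.maximalRealSubfield L)}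
    {𝔫 : Ideal (𝓞 ↥(NumberField.maximalRealSubfield L))}
    (B : ArchKTypeDataAt (thetaSpaceInputIn hHD hI h₁ h₃ S h) k xc 𝔫)
    (f : C(relNormOneIdeles (NumberField.maximalRealSubfield L) L ⧸ relNormOneRat (NumberField.maximalRealSubfield L) L, ℂ)) :
    (thetaSpaceInputIn hHD hI h₁ h₃ S h).GU → (Fin 2 → ℂ) :=
  fun y => (B.thetaFormOf f).1 y

/-- **Holomorphic germs of the theta form of the family at every adelic base point** ((H1) + (AN) + (REP′)). -/
theorem ArchKTypeDataAt.isHolGerm_thetaFormOf_of_isWeaklyCR (S : ThetaAdelicSide V c) (h : IsAnisotropic L V.Hm)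
    {k : Fin 4} {xc : Fin 3 → FiniteAdeleRing (𝓞 ↥(NumberField.maximalRealSubfield L)) ↥(NumberField.maximalRealSubfield L)}
    {𝔫 : Ideal (𝓞 ↥(NumberField.maximalRealSubfield L))}
    (B : ArchKTypeDataAt (thetaSpaceInputIn hHD hI h₁ h₃ S h) k xc 𝔫)
    (hT : ((thetaSpaceInputIn hHD hI h₁ h₃ S h).P k).IsThetaArchContinuousAt xc 𝔫)
    (hd : B.IsWeaklyPDiff BallForms.expP) (hCR : B.IsWeaklyCR BallForms.expP)
    (f : C(relNormOneIdeles (NumberField.maximalRealSubfield L) L ⧸ relNormOneRat (NumberField.maximalRealSubfield L) L, ℂ)) :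
    IsHolGerm ((thetaSpaceInputIn hHD hI h₁ h₃ S h).ιinf B.Γ₀) (B.thetaFunIn f) := by
  refine ⟨fun y => ?_, fun y v => ?_⟩
  · exact (ThetaHolAssembly.differentiableAt_and_fderiv_I_smul_pi
      (Fv := fun b : Fin 2 → ℂ => B.thetaFunIn f (y * (thetaSpaceInputIn hHD hI h₁ h₃ S h).ιinf B.Γ₀ (BallForms.expP b)))
      (fun j => (B.differentiableAt_apply_thetaFormOf BallForms.expP hT hd hCR f y (LinearMap.proj j)).1)
      (fun j v => (B.differentiableAt_apply_thetaFormOf BallForms.expP hT hd hCR f y (LinearMap.proj j)).2 v)).1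
  · exact (ThetaHolAssembly.differentiableAt_and_fderiv_I_smul_pi
      (Fv := fun b : Fin 2 → ℂ => B.thetaFunIn f (y * (thetaSpaceInputIn hHD hI h₁ h₃ S h).ιinf B.Γ₀ (BallForms.expP b)))
      (fun j => (B.differentiableAt_apply_thetaFormOf BallForms.expP hT hd hCR f y (LinearMap.proj j)).1)
      (fun j v => (B.differentiableAt_apply_thetaFormOf BallForms.expP hT hd hCR f y (LinearMap.proj j)).2 v)).2 v

/-- **`IsHolType` of the situation at the thin coset, at every `k`.** -/
theorem ArchKTypeDataAt.isHolType_of_isWeaklyCR (S : ThetaAdelicSide V c) (h : IsAnisotropic L V.Hm)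
    {k : Fin 4} {xc : Fin 3 → FiniteAdeleRing (𝓞 ↥(NumberField.maximalRealSubfield L)) ↥(NumberField.maximalRealSubfield L)}
    {𝔫 : Ideal (𝓞 ↥(NumberField.maximalRealSubfield L))}
    (B : ArchKTypeDataAt (thetaSpaceInputIn hHD hI h₁ h₃ S h) k xc 𝔫)
    (hT : ((thetaSpaceInputIn hHD hI h₁ h₃ S h).P k).IsThetaArchContinuousAt xc 𝔫)
    (hd : B.IsWeaklyPDiff BallForms.expP) (hCR : B.IsWeaklyCR BallForms.expP)
    (𝓕 : Set C(relNormOneIdeles (NumberField.maximalRealSubfield L) L ⧸ relNormOneRat (NumberField.maximalRealSubfield L) L, ℂ)) :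
    IsHolType hHD hI h₁ h₃ S h B.Γ₀ k B.situation 𝓕 := by
  refine isHolType_of_generators hHD hI h₁ h₃ S h B.Γ₀ k B.situation 𝓕 fun j hj f _ => ?_
  rw [ArchKTypeDataAt.situation_𝓙, Set.mem_singleton_iff] at hj
  subst hj
  exact B.isHolGerm_thetaFormOf_of_isWeaklyCR hHD hI h₁ h₃ S h hT hd hCR f

/-- **`adm₃₄` of the situation at the thin coset** ((Θ-sat) + (SS-K) + (H1) + (AN) + (REP′)). -/
theorem ArchKTypeDataAt.adm₃₄_of_isWeaklyCR (S : ThetaAdelicSide V c) (h : IsAnisotropic L V.Hm)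
    {k : Fin 4} {xc : Fin 3 → FiniteAdeleRing (𝓞 ↥(NumberField.maximalRealSubfield L)) ↥(NumberField.maximalRealSubfield L)}
    {𝔫 : Ideal (𝓞 ↥(NumberField.maximalRealSubfield L))}
    (B : ArchKTypeDataAt (thetaSpaceInputIn hHD hI h₁ h₃ S h) k xc 𝔫)
    (hT : ((thetaSpaceInputIn hHD hI h₁ h₃ S h).P k).IsThetaArchContinuousAt xc 𝔫)
    (hd : B.IsWeaklyPDiff BallForms.expP) (hCR : B.IsWeaklyCR BallForms.expP) :
    adm₃₄ hHD hI h₁ h₃ S h B.Γ₀ k B.situation :=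
  ⟨B.situation_isSaturated, B.situation_isStrict, B.isHolType_of_isWeaklyCR hHD hI h₁ h₃ S h hT hd hCR _⟩

/-- **`adm₃₄` at the thin coset — (REP) along `-i e_0`, `-i e_1`, (H1) as LF-continuity of the pair action.** -/
theorem ArchKTypeDataAt.adm₃₄_of_isPMinusKilledAlong (S : ThetaAdelicSide V c) (h : IsAnisotropic L V.Hm)
    {k : Fin 4} {xc : Fin 3 → FiniteAdeleRing (𝓞 ↥(NumberField.maximalRealSubfield L)) ↥(NumberField.maximalRealSubfield L)}
    {𝔫 : Ideal (𝓞 ↥(NumberField.maximalRealSubfield L))}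
    (B : ArchKTypeDataAt (thetaSpaceInputIn hHD hI h₁ h₃ S h) k xc 𝔫)
    (hLF : ((thetaSpaceInputIn hHD hI h₁ h₃ S h).P k).IsLFAction)
    (hd : B.IsWeaklyPDiff BallForms.expP)
    (hk : ∀ p : Fin 2, B.IsPMinusKilledAlong BallForms.expP (-Complex.I • (Pi.single p 1 : Fin 2 → ℂ))) :
    adm₃₄ hHD hI h₁ h₃ S h B.Γ₀ k B.situation :=
  B.adm₃₄_of_isWeaklyCR hHD hI h₁ h₃ S h
    (((thetaSpaceInputIn hHD hI h₁ h₃ S h).P k).isThetaArchContinuousAt_of_isLFAction hLF xc 𝔫) hd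
    (B.isWeaklyCR_of_isPMinusKilledAlong BallForms.expP_zero hd (fun _ => -Complex.I) (fun _ => by simp) hk)

/-- **The frame equation of the family** (`rfl`). -/
theorem ArchKTypeDataAt.toThetaTop_frame (S : ThetaAdelicSide V c) (h : IsAnisotropic L V.Hm)
    {k : Fin 4} {xc : Fin 3 → FiniteAdeleRing (𝓞 ↥(NumberField.maximalRealSubfield L)) ↥(NumberField.maximalRealSubfield L)}
    {𝔫 : Ideal (𝓞 ↥(NumberField.maximalRealSubfield L))}
    (B : ArchKTypeDataAt (thetaSpaceInputIn hHD hI h₁ h₃ S h) k xc 𝔫) (a : Fin 2) :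
    ((thetaSpaceInputIn hHD hI h₁ h₃ S h).P k).weilDatum.toThetaTop (B.Φfam (LinearMap.proj a)) =
      (⟨B.jFam, B.isThetaEquivariant_family⟩ :
          {j : B.situation.E →ₗ[ℂ] ((thetaSpaceInputIn hHD hI h₁ h₃ S h).P k).weilDatum.ThetaTop //
            ((thetaSpaceInputIn hHD hI h₁ h₃ S h).P k).kernelDatum.IsThetaEquivariant B.situation.κ B.situation.σ j}).1
        (B.situation.ι (LinearMap.proj a)) :=
  rfl

/-- **The packaged admissible frame at the thin coset** — the per-line input of `wedge_mem_admWedgeSpan`. -/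
theorem ArchKTypeDataAt.exists_adm₃₄_frame_of_isPMinusKilledAlong (S : ThetaAdelicSide V c) (h : IsAnisotropic L V.Hm)
    {k : Fin 4} {xc : Fin 3 → FiniteAdeleRing (𝓞 ↥(NumberField.maximalRealSubfield L)) ↥(NumberField.maximalRealSubfield L)}
    {𝔫 : Ideal (𝓞 ↥(NumberField.maximalRealSubfield L))}
    (B : ArchKTypeDataAt (thetaSpaceInputIn hHD hI h₁ h₃ S h) k xc 𝔫)
    (hLF : ((thetaSpaceInputIn hHD hI h₁ h₃ S h).P k).IsLFAction)
    (hd : B.IsWeaklyPDiff BallForms.expP)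
    (hk : ∀ p : Fin 2, B.IsPMinusKilledAlong BallForms.expP (-Complex.I • (Pi.single p 1 : Fin 2 → ℂ))) :
    ∃ (Sit : KTypeSituation ((thetaSpaceInputIn hHD hI h₁ h₃ S h).P k)
        ((thetaSpaceInputIn hHD hI h₁ h₃ S h).ιinf B.Γ₀) ((thetaSpaceInputIn hHD hI h₁ h₃ S h).Δ B.Γ₀)
        (thetaSpaceInputIn hHD hI h₁ h₃ S h).κ₁ (thetaSpaceInputIn hHD hI h₁ h₃ S h).τ₁)
      (j : {j : Sit.E →ₗ[ℂ] ((thetaSpaceInputIn hHD hI h₁ h₃ S h).P k).weilDatum.ThetaTop //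
        ((thetaSpaceInputIn hHD hI h₁ h₃ S h).P k).kernelDatum.IsThetaEquivariant Sit.κ Sit.σ j}),
      (adm₃₄ hHD hI h₁ h₃ S h B.Γ₀ k Sit ∧ j ∈ Sit.𝓙) ∧
        ∀ a : Fin 2, ((thetaSpaceInputIn hHD hI h₁ h₃ S h).P k).weilDatum.toThetaTop
            (B.Φfam (LinearMap.proj a)) = j.1 (Sit.ι (LinearMap.proj a)) :=
  ⟨B.situation, ⟨B.jFam, B.isThetaEquivariant_family⟩,
    ⟨B.adm₃₄_of_isPMinusKilledAlong hHD hI h₁ h₃ S h hLF hd hk, by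
      rw [ArchKTypeDataAt.situation_𝓙, Set.mem_singleton_iff]⟩,
    fun a => B.toThetaTop_frame hHD hI h₁ h₃ S h a⟩

/-- **The admissible (34) wedge of a pair of archimedean `K`-type data of lines `2`, `3` at ARBITRARY THIN COSETS `x₂ + 𝔫₂𝒪̂³`,
`x₃ + 𝔫₃𝒪̂³` and a common level** ((H1) as LF-continuity of the two pair actions + (AN) + (REP) along `-i e_p`, for both): the wedge of
the frames `tau34 (Φ₂(e₀^∨)) (Φ₃(e₁^∨)) − tau34 (Φ₂(e₁^∨)) (Φ₃(e₀^∨))`, `Φₖ(ℓ) = Φ_∞,k(ℓ) ⊗ 1_{xₖ + 𝔫ₖ𝒪̂³}`, lies in `admWedgeSpan … S₀ hV`. -/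
theorem ArchKTypeDataAt.wedge_mem_admWedgeSpan_of_isPMinusKilledAlong (S₀ : ThetaAdelicSide V c)
    (hV : IsAnisotropic L V.Hm)
    {x₂ x₃ : Fin 3 → FiniteAdeleRing (𝓞 ↥(NumberField.maximalRealSubfield L)) ↥(NumberField.maximalRealSubfield L)}
    {𝔫₂ 𝔫₃ : Ideal (𝓞 ↥(NumberField.maximalRealSubfield L))}
    (B₂ : ArchKTypeDataAt (thetaSpaceInputIn hHD hI h₁ h₃ S₀ hV) 2 x₂ 𝔫₂)
    (B₃ : ArchKTypeDataAt (thetaSpaceInputIn hHD hI h₁ h₃ S₀ hV) 3 x₃ 𝔫₃) (hΓ : B₃.Γ₀ = B₂.Γ₀)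
    (hLF₂ : ((thetaSpaceInputIn hHD hI h₁ h₃ S₀ hV).P 2).IsLFAction)
    (hd₂ : B₂.IsWeaklyPDiff BallForms.expP)
    (hk₂ : ∀ p : Fin 2, B₂.IsPMinusKilledAlong BallForms.expP (-Complex.I • (Pi.single p 1 : Fin 2 → ℂ)))
    (hLF₃ : ((thetaSpaceInputIn hHD hI h₁ h₃ S₀ hV).P 3).IsLFAction)
    (hd₃ : B₃.IsWeaklyPDiff BallForms.expP)
    (hk₃ : ∀ p : Fin 2, B₃.IsPMinusKilledAlong BallForms.expP (-Complex.I • (Pi.single p 1 : Fin 2 → ℂ))) :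
    tau34 V c.D (B₂.Φfam (LinearMap.proj 0)) (B₃.Φfam (LinearMap.proj 1)) -
        tau34 V c.D (B₂.Φfam (LinearMap.proj 1)) (B₃.Φfam (LinearMap.proj 0)) ∈
      admWedgeSpan hHD hI h₁ h₃ S₀ hV := by
  have hφ₂ := B₂.exists_adm₃₄_frame_of_isPMinusKilledAlong hHD hI h₁ h₃ S₀ hV hLF₂ hd₂ hk₂
  have hφ₃ := B₃.exists_adm₃₄_frame_of_isPMinusKilledAlong hHD hI h₁ h₃ S₀ hV hLF₃ hd₃ hk₃
  rw [hΓ] at hφ₃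
  obtain ⟨Sit₂, j₂, ⟨hadm₂, hj₂⟩, hfr₂⟩ := hφ₂
  obtain ⟨Sit₃, j₃, ⟨hadm₃, hj₃⟩, hfr₃⟩ := hφ₃
  exact wedge_mem_admWedgeSpan hHD hI h₁ h₃ S₀ hV B₂.Γ₀ Sit₂ j₂ Sit₃ j₃
    (fun a => B₂.Φfam (LinearMap.proj a)) (fun a => B₃.Φfam (LinearMap.proj a)) ⟨hadm₂, hj₂, hadm₃, hj₃⟩ hfr₂ hfr₃

end Pin

/-! ## 4. Transport along an equality of adelic sides (for producers that build at `archSideOf …` and cast to the pin of record) -/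

section Transport

variable (hHD : exists_isReal_hodgeModel) (hI : hodgePQ_independent_of_hodgeModel)
  (h₁ : BallQuotientUniformised)  (h₃ : CMAbelianVarietyRealised)
variable {L : CMField} {ι₁ : L →+* ℂ} {V : HermSpace3 L ι₁} {c : SeesawCtx L} {hV : IsAnisotropic L V.Hm} {k : Fin 4}
  {xc : Fin 3 → FiniteAdeleRing (𝓞 ↥(NumberField.maximalRealSubfield L)) ↥(NumberField.maximalRealSubfield L)}
  {𝔫 : Ideal (𝓞 ↥(NumberField.maximalRealSubfield L))}

/-- **centre-indexed data transported along an equality of sides** `e : S₁ = S₂` (twin of `ArchKTypeData.castSide`). -/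
def ArchKTypeDataAt.castSide {S₁ S₂ : ThetaAdelicSide V c} (e : S₁ = S₂)
    (C : ArchKTypeDataAt (thetaSpaceInputIn hHD hI h₁ h₃ S₁ hV) k xc 𝔫) :
    ArchKTypeDataAt (thetaSpaceInputIn hHD hI h₁ h₃ S₂ hV) k xc 𝔫 :=
  e ▸ C

/-- (Ported verbatim from the HodgeCMPerL package; no docstring in the source.) -/
@[simp] theorem ArchKTypeDataAt.castSide_rfl {S₁ : ThetaAdelicSide V c}
    (C : ArchKTypeDataAt (thetaSpaceInputIn hHD hI h₁ h₃ S₁ hV) k xc 𝔫) :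
    ArchKTypeDataAt.castSide hHD hI h₁ h₃ rfl C = C := rfl

/-- the level is unchanged by transport. -/
theorem ArchKTypeDataAt.castSide_Γ₀ {S₁ S₂ : ThetaAdelicSide V c} (e : S₁ = S₂)
    (C : ArchKTypeDataAt (thetaSpaceInputIn hHD hI h₁ h₃ S₁ hV) k xc 𝔫) :
    (ArchKTypeDataAt.castSide hHD hI h₁ h₃ e C).Γ₀ = C.Γ₀ := by
  subst e; rfl

/-- the archimedean family is unchanged by transport (its type does not see the side). -/
theorem ArchKTypeDataAt.castSide_Φarch {S₁ S₂ : ThetaAdelicSide V c} (e : S₁ = S₂)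
    (C : ArchKTypeDataAt (thetaSpaceInputIn hHD hI h₁ h₃ S₁ hV) k xc 𝔫) :
    (ArchKTypeDataAt.castSide hHD hI h₁ h₃ e C).Φarch = C.Φarch := by
  subst e; rfl

/-- (AN) is invariant under transport. -/
theorem ArchKTypeDataAt.isWeaklyPDiff_castSide_iff {S₁ S₂ : ThetaAdelicSide V c} (e : S₁ = S₂)
    (C : ArchKTypeDataAt (thetaSpaceInputIn hHD hI h₁ h₃ S₁ hV) k xc 𝔫) :
    (ArchKTypeDataAt.castSide hHD hI h₁ h₃ e C).IsWeaklyPDiff BallForms.expP ↔ C.IsWeaklyPDiff BallForms.expP := by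
  subst e; rfl

/-- (REP) along a direction is invariant under transport. -/
theorem ArchKTypeDataAt.isPMinusKilledAlong_castSide_iff {S₁ S₂ : ThetaAdelicSide V c} (e : S₁ = S₂)
    (C : ArchKTypeDataAt (thetaSpaceInputIn hHD hI h₁ h₃ S₁ hV) k xc 𝔫) (v : Fin 2 → ℂ) :
    (ArchKTypeDataAt.castSide hHD hI h₁ h₃ e C).IsPMinusKilledAlong BallForms.expP v ↔
      C.IsPMinusKilledAlong BallForms.expP v := by
  subst e; rfl

end Transport

end Model
end HodgeCM

end
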